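import Mathlib
import HarnessLib
import HarnessLib.Audit
import Summits.BirchSwinnertonDyer.Statement
import Summits.BirchSwinnertonDyer.Rank2.LambdaTransportDoorAtTwo
import Summits.BirchSwinnertonDyer.Rank2.Family81517Defs
import Summits.BirchSwinnertonDyer.Rank1Residual.X1.MuLambdaAlgebra
import Literature.NumberTheory.EllipticCurves.LambdaInvariantCongruenceTransportAtTwo
import Literature.NumberTheory.EllipticCurves.CuspFormLFunction
import Literature.NumberTheory.EllipticCurves.PAdicBSD
import Literature.NumberTheory.EllipticCurves.PAdicLFunction
import HarnessLib.Audit.Status.Attr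

/-!
Route: MatsunoAnalyticTwin

CLOSED (superseded) 2026-08-27T08:24:11Z by planner-bsd-rank2-p2-g15-0 — reason: superseded:route-BirchSwinnertonDyer-CountingDoorF2AtThree — superseded by route-BirchSwinnertonDyer-CountingDoorF2AtThree — note: director-bsd g8 07:53:57Z ruling executed (shape A): X2 LambdaZeroAtFifteenRef became computation-certified EXACT after filing (lit GEN16 kit j272806+j272821) => support (retriage 08:11Z); only X1 AnalyticMatsunoTwinAtTwo remains a genuine open crux => NO 1-crux route. X1 = stmt-BirchSwinnertonDyer-. The file is kept as the record of this route; refuted decls are indexed as negative knowledge (`ledger negatives`).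

# Route MatsunoAnalyticTwin — analytic twin of Matsuno's λ-transport at 2 + one conductor-15
λ-certificate give λ(L₂) = 4 on the 8-15-17 family, closing the T-r3₂ door (corank = ord L₂ = 3 on
an infinite family)

X = X₁ ∧ X₂ with (X₁) «analytic Matsuno transport at 2»: for two globally minimal elliptic curves W,
W′/ℚ, good ordinary at 2,
each with exactly ONE rational point of order 2, of the same Greenberg type (A/A or B/B), any
newforms f, f′ attached to them and any
nonzero integral rational multiples L₀ = c·L₂(f, α_W), L₀′ = c′·L₂(f′, α_W′) of their 2-adic
L-functions, the SCALE-FREE λ-invariants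
obey λ(L₀) + Σ_S(W) = λ(L₀′) + Σ_S(W′), S = prime factors of N_W·N_W′, Σ_S = Matsuno's non-primitive
shift (tree
`matsunoSigmaShiftAtTwo`) — the ANALYTIC twin of Matsuno 2008 Thm 4.2 (algebraic λ, PRINT, tree fact
`matsuno2008_thm42_lambda_transport_two`, = Greenberg–Vatsal at p = 2); and (X₂) «λ-certificate at
15a8»: the conductor-15 curve
E₀ = [1,1,1,0,0] (torsion ℤ/4, 2-torsion abscissa −1, type B) has a newform and a nonzero integral
multiple of L₂(f₀, α) with λ = 0.
It suffices: pairing each member E of the 8-15-17 family (type B, unique 2-torsion (0,0)) with E₀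
gives λ(L₀(E)) = 0 + Σ_S(E₀) − Σ_S(E)
= 4 (support ReferencePairFactsRef: Σ_S(E) + 4 = Σ_S(E₀); support RefFifteenFactsRef: N = 15,
ordinary at 2, unique 2-torsion −1),
which with the banked door's algebraic λ(X) = 4, μ = 0 (`LambdaTransportDoor.lambdaFourMuZero_of`)
is exactly `MembersLambdaHalfAtTwo`,
the ONE input modulo which eng-2's landed door `LambdaTransportDoor.closes′` (p505328) proves the
leaf corank Sel_2^∞ = ord_T L₂ = 3 on 𝓕₋.
Lean: `Summit.BirchSwinnertonDyer.Rank2.Family81517.SelmerCorankEqOrderEqThreeOnOddFamily`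

## Assembly
Kernel-checked (folder Sketch.lean, farm rc 0, 0 sorry, against the TREE door):
`membersLambdaHalf_of_items` (the member's integral
multiple L₀ from `EisensteinLowerBounds.exists_integral_slack`; X₁ at the pair (E, [1,1,1,0,0]); X₂;
Σ_S(E) + 4 = Σ_S(E₀); λ(X) = 4 from
`LambdaTransportDoor.lambdaFourMuZero_of`; omega ⇒ lam L₀ ≤ 4 = D.lambda), then
`LambdaTransportDoor.closes′` (eng-2 p505328:
PublishedInputsAtTwo → RootNumberFacts → ReferenceFacts → MembersLambdaHalfAtTwo → Leaf). The
Assembly item below is PROVED in the sketch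
(`assembly_holds`, 25 lines; a prover lands it as Theorems/MatsunoAnalyticTwinAssembly.lean); the
deciding theorem is
`closes h1 h2 h3 h4 h5 h6 h7 hA := hA h1 h2 h3 h4 h5 h6 h7` — every binder consumed.

CLOSES_TARGET: closes rung S0 door T-r3₂ of BirchSwinnertonDyer: Summit.BirchSwinnertonDyer.Rank2.Family81517.SelmerCorankEqOrderEqThreeOnOddFamily (D-0061; not the summit Statement) — the deciding theorem of this route concludes that registered leaf instead of the Statement decl `BirchSwinnertonDyer` (class rung: servable and labelled, never counted as concluding the summit Statement).

UNDER FLOOR: fewer than 2 cruxes remain after retriage (legacy route; D-0019).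

Rationale: WHY THIS LINE. The door (F*) is a THEOREM modulo `MembersLambdaHalfAtTwo` (tree
p503607/p504094/p505328/p506144); the only routes to that input so far are
the 2adic cell's ∀-curve Eisenstein/GV halves of IMC₂ (items 19556/19272 — summit-adjacent, no print
at p = 2). This line replaces «prove a
half of IMC₂» by «analytic λ obeys the SAME local bookkeeping as algebraic λ under a
rational-2-torsion congruence» — a statement about the
Mazur–Tate/Mazur–Swinnerton-Dyer measures of two E[2]-congruent weight-2 forms, imported from the
ANALYTIC side of Iwasawa theory where it
is a theorem at odd p with ρ̄ irreducible (Vatsal1999 / GreenbergVatsal2000 §3 via Ihara's lemma and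
canonical periods — tree facts
`greenbergVatsal2000_plusSymbol_congruence`,
`GreenbergVatsal2000.lambda_nonPrimitive_eq_add_sum_delta`; EmertonPollackWeston2006 Cor 5.1.4
in Hida families — tree `EmertonPollackWeston2006.cor514_transfer_of_goodOrdinary`), plus ONE finite
2-adic modular-symbol computation
(SteinWuthrich2013 §3). What is new: p = 2 with ρ̄ REDUCIBLE (a rational 2-torsion point), where no
canonical-period statement is in print —
the crux is typed SCALE-FREE (λ of any nonzero rational multiple; μ never enters), which is what
makes it statable, and the reference is a
FIXED curve (15a8), legitimate because the kit numerics (j270999/j271233/j271742, memo PADIC-R2-G14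
§6.5) show the transport at 2 is
FIELD-FREE on Greenberg type-B classes (Λ* constant across 8 distinct 2-division fields), unlike
Matsuno's algebraic theorem which needs
ℚ(E[2]) = ℚ(E′[2]). Sources: Matsuno2008 (Thm 4.2, Prop 6.2, Remark p. 418), GreenbergVatsal2000,
Vatsal1999, GreenbergLNM1716 (§5 types),
Kato2004Asterisque (17.4/18.4 at p = 2, in the door), MazurTateTeitelbaum1986Invent,
SteinWuthrich2013, TaoZiegler2008, arXiv:2412.07308.

RANKED CRUXES. #2 AnalyticMatsunoTwinAtTwo (crux) — for globally minimal elliptic W, W′ good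
ordinary at 2 with unique rational 2-torsion points x, x′ of the same Greenberg type, newforms f, f′
of W, W′ (any levels), and nonzero integral rational multiples L₀, L₀′ of L₂(f, α_W), L₂(f′, α_W′):
lam L₀ + Σ_S(W) = lam L₀′ + Σ_S(W′), S = primeFactors(N_W·N_W′). [difficulty: XL] (why it might
fail: at p = 2 with ρ̄ reducible there is no Ihara/canonical-period control (multiplicity one at the
Eisenstein ideal can fail); a type-B pair in different 2-division fields or a hidden μ-jump
(17a-like) could break it — scan (30 classes, N ≤ 425): none inside the hypotheses.) [Matsuno2008,
GreenbergVatsal2000, Vatsal1999, MazurTateTeitelbaum1986Invent, arXiv:2412.07308]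
#3 LambdaZeroAtFifteenRef (crux) — E₀ = [1,1,1,0,0] (15a8) is elliptic and globally minimal, has a
weight-2 newform f₀, and some nonzero integral rational multiple of L₂(f₀, α) has λ = 0 (the
λ-clause only; a finite 2-adic modular-symbol certificate, modulo modularity of E₀). [difficulty: M]
(why it might fail: only by a modelling mismatch (tree `padicLFunction`/`unitRoot` normalisation vs
the modular-symbol computation) or a μ-surprise in the constant term; numerically (μ,λ) = (·,0)
stable at Riemann-sum levels 8–11 (kit j270999, j271233).) [SteinWuthrich2013,
MazurTateTeitelbaum1986Invent]
#9 RefFifteenFactsRef (support) — [1,1,1,0,0] is elliptic and globally minimal, N = 15, good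
ordinary at 2 (Δ = −15 odd, a₂ = −1), and (−1, 0) is its unique rational point of order 2
(2-division cubic (x+1)(4x²+x+1), disc −15) — eng-2 census 07:21Z: all three provable now on the
p507532/p508817 template. [difficulty: provable-now] [Matsuno2008, LMFDB]
#9 ReferencePairFactsRef (support) — every admissible member E = curve j n has the unique rational
2-torsion point (0,0), of the same Greenberg type (B) as ([1,1,1,0,0], −1), and Σ_S(E) + 4 = Σ_S(E₀)
over S = primeFactors(N_E·15) = {3, 5, m, q, r} (E multiplicative at 3, 5, m, r, additive at q; E₀
multiplicative at 3, 5, good with even point count at m, q, r). [difficulty: M] [Matsuno2008,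
GreenbergLNM1716]
#9 PublishedInputsAtTwo (support) — the banked door's fact pack at p = 2 (Kato 18.4 at 2 on the
family, Tao–Ziegler infinitude, Matsuno 4.2/6.2, Greenberg 5.14 and 1.9 at ℚ(√2), Monsky, level =
conductor) BY NAME — a theorem from named Literature facts (`publishedInputsAtTwo_of_named_facts`,
p505328). [difficulty: open-problem] [Kato2004Asterisque, TaoZiegler2008, Matsuno2008,
GreenbergLNM1716]
#9 RootNumberFacts (support) — on admissible members with OddSign, E and E^(2) have odd analytic
rank (door support BY NAME; local root numbers at 3, 5, m, q, r and 2; kit-verified 14/14).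
[difficulty: M] [Matsuno2008]
#9 ReferenceFacts (support) — the algebraic reference pair (E″ full 2-torsion, E′ = E″/⟨(25m,0)⟩ ∼
E) satisfies Matsuno's hypotheses member-wise and 4 + Σ(E) = LAW(N_E″) − 2 + Σ(E′) (door support BY
NAME; kit-verified 14/14). [difficulty: M] [Matsuno2008]

TWO-LAYER PLAN. Kernel-checked children (HOME/p2/g15/SketchG15.lean, not filed as items; re-homed to
Cruxes/…/Lines/birth.lean after open):
`analyticTwin_of_law : AnalyticMatsunoLawAtTwo → SigmaLawIdentityAtTwo → OddConductorOfOrdinaryAtTwo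
→ AnalyticMatsunoTwinAtTwo` (X₁ ⇐ the
one-line law (L) «type-A/B unique 2-torsion ⇒ λ(L₀) + 2 = LAW(N_W)» + the elementary shift identity
(I) «LAW(N_W) + Σ_S(W) = 2·Σ_ℓ∈S 2^n_ℓ» +
«2 ∤ N_W») and `lambdaZeroRef_of_law : AnalyticMatsunoLawAtTwo → RefFifteenFacts →
LambdaZeroAtFifteenRef`. So the route is a CONJUNCT SPLIT of
(L): X₂ its decidable instance (certificate), X₁ its uniform transport part; (L)'s own foreseen
children: (a) Eisenstein congruence of the
level-2^m Mazur–Tate elements of f modulo the 2-isogeny Eisenstein ideal with an explicit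
Kubota–Leopoldt/Stickelberger product G, (b) λ(G) + 2
= LAW(N_W) scale-free (cyclotomic arithmetic at 2, Ferrero–Washington/Kida). Alternative
decomposition (Matsuno's exact hypotheses): X₁ only
for pairs with the same 2-division field + the analytic Prop 6.2 twin for full-2-torsion curves +
isogeny invariance of L₂ (member-dependent
reference).

KILL CRITERIA. X₁ is refuted by ONE pair of type-B (or type-A) unique-2-torsion good-ordinary curves
with λ(L₀) + Σ_S(W) ≠ λ(L₀′) + Σ_S(W′) certified (2-adic
modular symbols, two levels agreeing) — close --reason refuted:AnalyticMatsunoTwinAtTwo; if the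
counterexample has different 2-division
fields, the misstated-repair is Matsuno's exact hypothesis `IsSquare (Δ·Δ′)` with a member-dependent
reference (then X₂ becomes the analytic
Prop 6.2 twin). X₂ is refuted by a certified λ₂,an(15a) ≥ 1. The door itself dies only with a member
of 𝓕₋ having ord_T L₂ ≥ 5.

NOT DECOMPOSED YET. The mechanism behind X₁ (children (a)/(b) above); the Lean certificate format
for X₂ (eng-2 census 07:21Z: the λ-clause needs the VALUE
[0]⁺(15a) = L(E₀,1)/Ω⁺ as a computation fact and a μ/denominator bound for reducible E[2] — neither
is in the tree; plan-only BC5 rung).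

CHEAPEST FALSIFIER. RUN (kit j270999/j271233/j271742, tag bsd-rank2; HOME/p2/g15/e0scan_v4.gp,
classcheck.gp, analyze_scan.py): 30 good-ordinary rational-2-torsion
classes N ≤ 425 — type-B rows: Λ* = λ + Σσ constant (10/10) across 8 two-division fields (X₁: no
counterexample); the closed form λ₂,an =
LAW(N) − 2 holds on every class with a type-A/B unique-2-torsion curve (20/20 + 425: 0/2 new
exceptions both outside the hypotheses);
λ₂,an(15a) = 0 at levels 8–11 (X₂). Next cheapest: type-B pairs with DIFFERENT fields sharing a
large prime; type-A pairs; scans j271490/j271492.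

NUMBERS. Family: N_E = 3·5·m·q²·r, m, q, r ≡ 3 (mod 8) ⇒ n_ℓ = 0, LAW(N_E) = 6, Σ_S(E) = 1+1+1+0+1 =
4 (S = {3,5,m,q,r}), Σ_S(E₀) = 1+1+2+2+2 = 8, so
λ(L₀(E)) = λ(L₀(E₀)) + 8 − 4 = 4 = λ_alg. E₀ = 15a8: [1,1,1,0,0], torsion ℤ/4, 2-torsion (−1, 0),
(μ,λ)(θ_m) = (·, 0) for m = 8…11.

DEFINITION REQUESTS. - none: all notions exist (`lam`, `iwasawaToPowerSeries`, `padicLFunction`,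
`unitRoot`, `IsNewformOf`, `matsunoSigmaShiftAtTwo`, `HasUniqueRationalTwoTorsionX`,
`SameGreenbergTypeAB`, `Family81517.curve/AdmissibleF`).

Novelty: Searches (G13–G15): lit search --hybrid "Mazur-Tate elements congruences lambda invariant p = 2" /
"Greenberg Vatsal p = 2 reducible" / "Iwasawa invariants 2-adic L-function elliptic curve rational
2-torsion"; lit vsearch "analytic lambda invariant of congruent modular forms at the prime 2"; lit
galaxy search "lambda-invariant|Mazur-Tate|2-adic L-function" --star all; lean search
matsunoSigmaShiftAtTwo / plusSymbol_congruence / lambda_nonPrimitive.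
Nearest prior art found: Matsuno2008 Thm 4.2 / Prop 6.2 [corpus:matsuno2008 p.413, p.418] (ALGEBRAIC
λ only; needs E[2] ≅ E′[2]); GreenbergVatsal2000 §3 + Vatsal1999 (analytic transport, p odd, ρ̄
irreducible — tree `greenbergVatsal2000_plusSymbol_congruence`, hypotheses `p ≠ 2`,
`HasIrreducibleModPGaloisRep`; [corpus:paper:arxiv-1909.01764 p.3–4, p.11]); Bellaïche–Pollack
(reducible ρ̄, odd p, tame level: λ = 0) [galaxy:pdf:-4456907251306002080 p.1]; Pollack–Weston
Mazur–Tate elements («Fix an odd prime p») [galaxy:pdf:-6535538855114364040 p.1];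
EmertonPollackWeston2006 (Hida families, p odd; tree `cor514_transfer_of_goodOrdinary`);
arXiv:2412.07308 (numerics); no hits at p = 2 for "Iwasawa invariants of elliptic curves" /
"canonical periods and congruence" (galaxy pdf/panama/crabby) nor "2-adic L-function lambda
invariant rational 2-torsion transport" (corpus fts+vec). Nearest listed routes: TwoAdicConverse
item 19556 `OrdLambdaHalfAtTwo` / ByReductionTypeAtTwo 19272 (∀-curve λ- /Eisenstein-halves of IMC₂ —
an INEQUALITY λ_an ≤ λ_  [refs: 2412.07308, paper:arxiv-1909.01764, Matsuno2008, GreenbergVatsal2000, Vatsal1999, EmertonPollackWeston2006]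

Barriers (technique_class: analytic-lambda-transport-2, mazur-tate, certificate): - technique_class: analytic-lambda-transport-2, mazur-tate, certificate
- Literature.Barriers.BirchSwinnertonDyer.SelmerRankBarrierNarrow: not engaged — the leaf is in
Selmer-corank / p-adic-order currency (corank Sel_{2^∞} = ord_T L₂ = 3); no claim about E(ℚ) or Ш,
so the Selmer-vs-Mordell–Weil gap is never crossed by this route.
- Literature.Barriers.BirchSwinnertonDyer.HeegnerPointBarrier: not engaged — no Heegner points;
members have corank 3, the route is p-adic-analytic (λ-invariants) only.
- Literature.Barriers.BirchSwinnertonDyer.NumericalVanishingBarrier: evaded — no claim L″(E,1) = 0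
or r_an = 2 exactly; X₂'s certificate is λ = 0 (a unit coefficient of a 2-adic power series), a
NON-vanishing check decided by a finite modular-symbol computation.
- Literature.Barriers.BirchSwinnertonDyer.EisensteinMuBarrier: outside — its theorems carry `hp : p
≠ 2` and concern μ ≥ 1 for ramified odd lines; X₁ is typed scale-free (λ of the p-free part only)
and never asserts μ = 0, X₂ allows any μ (lam of an integral multiple).
- Literature.Barriers.BirchSwinnertonDyer.PAdicHeightBarrier: not engaged — no p-adic heights or
regulators enter; the equality corank = ord is read off λ(L₂) = 4 = corank + 1 parity bookkeeping
inside the banked door, not from height non-degeneracy.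
- Literature.Barriers.BirchSwinnertonDyer.SignedIwasawaTheoryAtTwoBarrier: not engaged — members and
the reference 15a8 are good ORDINARY at 2 (p510347 `refFifteen_isOrdinaryAt_two`,
Family81517MinimalOrdinary); no

History (route lifecycle, newest last):
- 2026-08-27T08:24:11Z · CLOSED superseded — superseded:route-BirchSwinnertonDyer-CountingDoorF2AtThree (close fields restored by operator from the route-closed event after a lost update) (planner-bsd-rank2-p2-g15-0)

sub-problem: BirchSwinnertonDyer · status: closed(superseded) · opened planner-bsd-rank2-p2-g15-0 2026-08-27T07:52:03Z · rev 1 · ledger route-BirchSwinnertonDyer-MatsunoAnalyticTwin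
GENERATED by the gate from the ledger (D-0016/17). Provers cite these decls: `theorem foo : Summit.BirchSwinnertonDyer.BirchSwinnertonDyer.Theses.MatsunoAnalyticTwin.<Decl> := …` in Summits/BirchSwinnertonDyer/BirchSwinnertonDyer/Theorems/<Name>.lean.
-/

namespace Summit.BirchSwinnertonDyer.BirchSwinnertonDyer.Theses.MatsunoAnalyticTwin

open scoped BigOperators Topology Manifold Classical MeasureTheory ProbabilityTheory Matrix InnerProductSpace ComplexConjugate ContinuousMap
open Filter Set Function TopologicalSpace MeasureTheory

attribute [summit_statement] _root_.BirchSwinnertonDyer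
attribute [summit_statement] _root_.Summit.BirchSwinnertonDyer.Rank2.Family81517.SelmerCorankEqOrderEqThreeOnOddFamily

open Literature

/-- item stmt-BirchSwinnertonDyer-20286 · crux · rank 2 · open · by planner
why it might fail: p = 2, E[2] reducible: no Ihara/canonical-period control (multiplicity one at the Eisenstein ideal can fail); a type-B pair in different 2-division fields or a hidden mu-jump (17a-like) could break it. 30 classes scanned (N <= 425): none inside the hypotheses; wider scan kit j272856.
sources: Matsuno2008, GreenbergVatsal2000, Vatsal1999, MazurTateTeitelbaum1986Invent, arXiv:2412.07308
[crux] for globally minimal elliptic W, W′ good ordinary at 2 with unique rational 2-torsion points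
x, x′ of the same Greenberg type, newforms f, f′ of W, W′ (any levels), and nonzero integral
rational multiples L₀, L₀′ of L₂(f, α_W), L₂(f′, α_W′): lam L₀ + Σ_S(W) = lam L₀′ + Σ_S(W′), S =
primeFactors(N_W·N_W′). [difficulty: XL] -/
@[route_item "route-BirchSwinnertonDyer-MatsunoAnalyticTwin", crux]
def AnalyticMatsunoTwinAtTwo : Prop :=
  ∀ (W W' : WeierstrassCurve ℚ) [W.IsElliptic] [W.IsGloballyMinimal] [W'.IsElliptic] [W'.IsGloballyMinimal] (x x' : ℚ), Literature.NumberTheory.EllipticCurves.IsOrdinaryAt W 2 → Literature.NumberTheory.EllipticCurves.IsOrdinaryAt W' 2 → Literature.NumberTheory.EllipticCurves.HasUniqueRationalTwoTorsionX W x → Literature.NumberTheory.EllipticCurves.HasUniqueRationalTwoTorsionX W' x' → Literature.NumberTheory.EllipticCurves.SameGreenbergTypeAB W x W' x' → ∀ ⦃N : ℕ⦄ [NeZero N] (f : CuspForm (CongruenceSubgroup.Gamma0 N) 2) ⦃N' : ℕ⦄ [NeZero N'] (f' : CuspForm (CongruenceSubgroup.Gamma0 N') 2), Literature.NumberTheory.EllipticCurves.ModularForms.IsNewformOf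 W f → Literature.NumberTheory.EllipticCurves.ModularForms.IsNewformOf W' f' → ∀ (c c' : ℚ) (L₀ L₀' : Literature.NumberTheory.EllipticCurves.IwasawaAlgebra 2), L₀ ≠ 0 → L₀' ≠ 0 → Literature.NumberTheory.EllipticCurves.iwasawaToPowerSeries 2 L₀ = PowerSeries.C (c : ℚ_[2]) * Literature.NumberTheory.EllipticCurves.padicLFunction f (Literature.NumberTheory.EllipticCurves.unitRoot W 2 : ℚ_[2]) → Literature.NumberTheory.EllipticCurves.iwasawaToPowerSeries 2 L₀' = PowerSeries.C (c' : ℚ_[2]) * Literature.NumberTheory.EllipticCurves.padicLFunction f' (Literature.NumberTheory.EllipticCurves.unitRoot W' 2 : ℚ_[2]) → Summit.BirchSwinnertonDyer.Rank1Residual.X1.MuLambda.lam L₀ + Literature.NumberTheory.EllipticCurves.matsunoSigmaShiftAtTwo W (W.conductorNorm ℤ * W'.conductorNorm ℤ).primeFactors = Summit.BirchSwinnertonDyer.Rank1Residual.X1.MuLambda.lam L₀' + Literature.NumberTheory.EllipticCurves.matsunoSigmaShiftAtTwo W' (W.conductorNorm ℤ * W'.conductorNorm ℤ).primeFactors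

/-- item stmt-BirchSwinnertonDyer-20287 · support · rank 3 · closed · moot by None · by planner
why it might fail: only by a modelling mismatch (tree `padicLFunction`/`unitRoot` normalisation vs the modular-symbol computation) or a μ-surprise in the constant term; numerically (μ,λ) = (·,0) stable at Riemann-sum levels 8–11 (kit j270999, j271233).
sources: SteinWuthrich2013, MazurTateTeitelbaum1986Invent, kit:j272806, kit:j272821
[crux] E₀ = [1,1,1,0,0] (15a8) is elliptic and globally minimal, has a weight-2 newform f₀, and some
nonzero integral rational multiple of L₂(f₀, α) has λ = 0 (the λ-clause only; a finite 2-adic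
modular-symbol certificate, modulo modularity of E₀). [difficulty: M] -/
@[route_item "route-BirchSwinnertonDyer-MatsunoAnalyticTwin", crux (experiment := "instrument: kit jobs cited as sources kit:j272806, kit:j272821") (source := "ledger wanted_by.sources on stmt-BirchSwinnertonDyer-20287, 2026-09-01")]
def LambdaZeroAtFifteenRef : Prop :=
  ∃ (_ : (⟨1, 1, 1, 0, 0⟩ : WeierstrassCurve ℚ).IsElliptic) (hmin : (⟨1, 1, 1, 0, 0⟩ : WeierstrassCurve ℚ).IsGloballyMinimal) (N : ℕ) (_ : NeZero N) (f : CuspForm (CongruenceSubgroup.Gamma0 N) 2), Literature.NumberTheory.EllipticCurves.ModularForms.IsNewformOf (⟨1, 1, 1, 0, 0⟩ : WeierstrassCurve ℚ) f ∧ ∃ (c : ℚ) (L₀ : Literature.NumberTheory.EllipticCurves.IwasawaAlgebra 2), L₀ ≠ 0 ∧ Literature.NumberTheory.EllipticCurves.iwasawaToPowerSeries 2 L₀ = PowerSeries.C (c : ℚ_[2]) * Literature.NumberTheory.EllipticCurves.padicLFunction f (@Literature.NumberTheory.EllipticCurves.unitRoot (⟨1, 1, 1, 0, 0⟩ : WeierstrassCurve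 ℚ) hmin 2 _ : ℚ_[2]) ∧ Summit.BirchSwinnertonDyer.Rank1Residual.X1.MuLambda.lam L₀ = 0

/-- item stmt-BirchSwinnertonDyer-20288 · support · rank 9 · closed · moot by None · by planner
sources: Matsuno2008, LMFDB
[support] [1,1,1,0,0] is elliptic and globally minimal, N = 15, good ordinary at 2 (Δ = −15 odd, a₂
= −1), and (−1, 0) is its unique rational point of order 2 (2-division cubic (x+1)(4x²+x+1), disc
−15) — eng-2 census 07:21Z: all three provable now on the p507532/p508817 template. [difficulty:
provable-now] -/
@[route_item "route-BirchSwinnertonDyer-MatsunoAnalyticTwin", crux]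
def RefFifteenFactsRef : Prop :=
  ∃ (_ : (⟨1, 1, 1, 0, 0⟩ : WeierstrassCurve ℚ).IsElliptic) (hmin : (⟨1, 1, 1, 0, 0⟩ : WeierstrassCurve ℚ).IsGloballyMinimal), (⟨1, 1, 1, 0, 0⟩ : WeierstrassCurve ℚ).conductorNorm ℤ = 15 ∧ @Literature.NumberTheory.EllipticCurves.IsOrdinaryAt (⟨1, 1, 1, 0, 0⟩ : WeierstrassCurve ℚ) hmin 2 _ ∧ Literature.NumberTheory.EllipticCurves.HasUniqueRationalTwoTorsionX (⟨1, 1, 1, 0, 0⟩ : WeierstrassCurve ℚ) (-1)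

/-- item stmt-BirchSwinnertonDyer-20289 · support · rank 9 · closed · moot by None · by planner
sources: Matsuno2008, GreenbergLNM1716
[support] every admissible member E = curve j n has the unique rational 2-torsion point (0,0), of
the same Greenberg type (B) as ([1,1,1,0,0], −1), and Σ_S(E) + 4 = Σ_S(E₀) over S =
primeFactors(N_E·15) = {3, 5, m, q, r} (E multiplicative at 3, 5, m, r, additive at q; E₀
multiplicative at 3, 5, good with even point count at m, q, r). [difficulty: M] -/
@[route_item "route-BirchSwinnertonDyer-MatsunoAnalyticTwin", crux]
def ReferencePairFactsRef : Prop :=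
  ∀ j n : ℤ, Summit.BirchSwinnertonDyer.Rank2.Family81517.AdmissibleF j n → ∀ (_ : (Summit.BirchSwinnertonDyer.Rank2.Family81517.curve j n).IsGloballyMinimal) (_ : (⟨1, 1, 1, 0, 0⟩ : WeierstrassCurve ℚ).IsGloballyMinimal), Literature.NumberTheory.EllipticCurves.HasUniqueRationalTwoTorsionX (Summit.BirchSwinnertonDyer.Rank2.Family81517.curve j n) 0 ∧ Literature.NumberTheory.EllipticCurves.SameGreenbergTypeAB (Summit.BirchSwinnertonDyer.Rank2.Family81517.curve j n) 0 (⟨1, 1, 1, 0, 0⟩ : WeierstrassCurve ℚ) (-1) ∧ Literature.NumberTheory.EllipticCurves.matsunoSigmaShiftAtTwo (Summit.BirchSwinnertonDyer.Rank2.Family81517.curve j n) ((Summit.BirchSwinnertonDyer.Rank2.Family81517.curve j n).conductorNorm ℤ * (⟨1, 1, 1, 0, 0⟩ : WeierstrassCurve ℚ).conductorNorm ℤ).primeFactors + 4 = Literature.NumberTheory.EllipticCurves.matsunoSigmaShiftAtTwo (⟨1, 1, 1, 0, 0⟩ : WeierstrassCurve ℚ) ((Summit.BirchSwinnertonDyer.Rank2.Family81517.curve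 j n).conductorNorm ℤ * (⟨1, 1, 1, 0, 0⟩ : WeierstrassCurve ℚ).conductorNorm ℤ).primeFactors

/-- item stmt-BirchSwinnertonDyer-20290 · support · rank 9 · closed · moot by None · by planner
sources: Kato2004Asterisque, TaoZiegler2008, Matsuno2008, GreenbergLNM1716
[support] the banked door's fact pack at p = 2 (Kato 18.4 at 2 on the family, Tao–Ziegler
infinitude, Matsuno 4.2/6.2, Greenberg 5.14 and 1.9 at ℚ(√2), Monsky, level = conductor) BY NAME — a
theorem from named Literature facts (`publishedInputsAtTwo_of_named_facts`, p505328). [difficulty: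
open-problem] -/
@[route_item "route-BirchSwinnertonDyer-MatsunoAnalyticTwin", crux]
def PublishedInputsAtTwo : Prop :=
  Summit.BirchSwinnertonDyer.Rank2.LambdaTransportDoor.PublishedInputsAtTwo

/-- item stmt-BirchSwinnertonDyer-20291 · support · rank 9 · closed · moot by None · by planner
sources: Matsuno2008
[support] on admissible members with OddSign, E and E^(2) have odd analytic rank (door support BY
NAME; local root numbers at 3, 5, m, q, r and 2; kit-verified 14/14). [difficulty: M] -/
@[route_item "route-BirchSwinnertonDyer-MatsunoAnalyticTwin", crux]
def RootNumberFacts : Prop :=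
  Summit.BirchSwinnertonDyer.Rank2.LambdaTransportDoor.RootNumberFacts

/-- item stmt-BirchSwinnertonDyer-20292 · support · rank 9 · closed · moot by None · by planner
sources: Matsuno2008
[support] the algebraic reference pair (E″ full 2-torsion, E′ = E″/⟨(25m,0)⟩ ∼ E) satisfies
Matsuno's hypotheses member-wise and 4 + Σ(E) = LAW(N_E″) − 2 + Σ(E′) (door support BY NAME;
kit-verified 14/14). [difficulty: M] -/
@[route_item "route-BirchSwinnertonDyer-MatsunoAnalyticTwin", crux]
def ReferenceFacts : Prop :=
  Summit.BirchSwinnertonDyer.Rank2.LambdaTransportDoor.ReferenceFacts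

/-- item stmt-BirchSwinnertonDyer-20293 · assembly · rank 1 · closed · moot by None · by planner
sources: Matsuno2008, GreenbergVatsal2000
[assembly] AnalyticMatsunoTwinAtTwo → LambdaZeroAtFifteenRef → RefFifteenFactsRef →
ReferencePairFactsRef → PublishedInputsAtTwo → RootNumberFacts → ReferenceFacts → Leaf_F₋. -/
@[route_item "route-BirchSwinnertonDyer-MatsunoAnalyticTwin", crux]
def Assembly : Prop :=
  AnalyticMatsunoTwinAtTwo → LambdaZeroAtFifteenRef → RefFifteenFactsRef → ReferencePairFactsRef → PublishedInputsAtTwo → RootNumberFacts → ReferenceFacts → Summit.BirchSwinnertonDyer.Rank2.Family81517.SelmerCorankEqOrderEqThreeOnOddFamily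

/-! D-0027 §2.1 — DECIDING THEOREM (planner-authored via `route open/edit --closes-file`; by planner-bsd-rank2-p2-g15-0 2026-08-27T07:52:03Z) — ARCHIVED: route closed (superseded) 2026-08-27T08:24:11Z; kept so importers keep building:
its hypotheses are this route's items and its conclusion the registered leaf `Summit.BirchSwinnertonDyer.Rank2.Family81517.SelmerCorankEqOrderEqThreeOnOddFamily` (rung S0 door T-r3₂, D-0061) (glue_lint), and it elaborates with this file. -/

@[closes "route-BirchSwinnertonDyer-MatsunoAnalyticTwin"] theorem closes (h1 : AnalyticMatsunoTwinAtTwo) (h2 : LambdaZeroAtFifteenRef) (h3 : RefFifteenFactsRef)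
    (h4 : ReferencePairFactsRef) (h5 : PublishedInputsAtTwo) (h6 : RootNumberFacts) (h7 : ReferenceFacts)
    (hA : Assembly) : Summit.BirchSwinnertonDyer.Rank2.Family81517.SelmerCorankEqOrderEqThreeOnOddFamily :=
  hA h1 h2 h3 h4 h5 h6 h7

end Summit.BirchSwinnertonDyer.BirchSwinnertonDyer.Theses.MatsunoAnalyticTwin
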